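import Literature.NumberTheory.EllipticCurves.IwasawaGeneratorChangeProofs
import Literature.NumberTheory.EllipticCurves.IwasawaSelmerIsTorsionProofs
import Literature.NumberTheory.EllipticCurves.IwasawaOrderOfVanishingProofs
import Literature.NumberTheory.EllipticCurves.PAdicBSD
import HarnessLib

/-!
# The `p`-adic NORM of the leading coefficient of `char_Λ X(E/ℚ_∞)` does not depend on the
# cyclotomic instantiation `(κ, γ, D, f_E)` — the leading-coefficient twin of
# `SelmerDualData.order_charGenerator_eq` (proofs; cell `b2b-bsdres`, team n1011, seat p16 GEN 6,
# row T-CCNU; placement = n1011-lit GEN 9's word: Literature `…Proofs` sibling of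
# `IwasawaGeneratorChangeProofs`)

A `…Proofs` sibling (theorems only: no definition, no named fact, no instance) of
`Literature.NumberTheory.EllipticCurves.IwasawaSelmer`, part (d) ("the Iwasawa invariants of
`X(E/K_∞)` do not depend on the topological generator"), continuing `IwasawaGeneratorChangeProofs`
(`SelmerDualData.order_charGenerator_eq`: `ord_T f` is one number) with the NORM OF THE LEADING
COEFFICIENT: for cyclotomic `ℤ_p`-extension data `κ, κ'` of `ℚ`, elements `γ, γ' ∈ Γ_ℚ` matching the
cyclotomic variable (`IsCyclotomicVariable`), Pontryagin-dual data `D` over `(κ, γ)` and `D'` over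
`(κ', γ')` of `Sel_{p^∞}(E/ℚ_∞)`, and generators `f, f'` of the two characteristic ideals with
`ord_T f = n`: **`‖[T^n] f'‖_p = ‖[T^n] f‖_p`.** In print this is the remark that the characteristic
power series is well defined up to `Λˣ` and that `ℤ_p⟦Γ⟧ ≅ ℤ_p⟦T⟧` depends only on the image of `γ` in
`Γ = Gal(ℚ_∞/ℚ)` (Washington, Thm. 7.1 and §13.2; Greenberg, LNM 1716, §1 p. 60); a change
`γ ↦ γ^u`, `u ∈ ℤ_pˣ`, would multiply `[T^n] f` by `u^n` (same norm) — not needed here, because two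
cyclotomic variables have the SAME image in `Γ` (Mazur–Tate–Teitelbaum §I.13). As in the sibling file,
the automorphism `T ↦ (1+T)^u − 1` is never constructed.

* §1 (algebra in `Λ = ℤ_p⟦T⟧`): (private) if `ord_T f = n` then `[T^n](w·f) = w(0)·[T^n] f`;
  `IwasawaAlgebra.norm_coeff_eq_of_span_singleton_eq` — `(f) = (g)` ⇒ `‖[T^n] g‖ = ‖[T^n] f‖`
  (`g = f·u`, `u(0) ∈ ℤ_pˣ`).
* §2 (fixed `(κ, γ)`): `SelmerDualData.norm_coeff_charGenerator_eq` — two data have the same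
  characteristic ideal (`SelmerDualData.charIdeal_eq`), so any two generators have lowest
  coefficients of equal norm.
* §3 (change of `γ` inside its class `mod ker κ`; two cyclotomic variables):
  `SelmerDualData.exists_of_inv_mul_mem_kerSubgroup` — a datum over `(κ, γ)` IS a datum over `(κ, γ')`
  when `γ⁻¹γ' ∈ ker κ` (same `X`, same `Λ`-structure: `conj_{γ'} = conj_γ` on `H¹(K_∞, E[p^∞])`,
  `conjH1_mul_holds` / `conjH1_of_mem_holds`); `ZpExtension.IsCyclotomic.inv_mul_mem_kerSubgroup_of_isCyclotomicVariable`
  — two cyclotomic variables differ by an element of `ker κ = χ_p⁻¹(μ(ℤ_p))`.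
* §4 `SelmerDualData.norm_coeff_charGenerator_eq_of_isCyclotomic` (MAIN) and
  `WeierstrassCurve.charCoeffNormUniform` — the statement in the binder shape of the cell's route
  planner 3 scratch `Prop` `CharCoeffNormUniform W p` (HOME/b2b-bsdres-n1011-r3/g18/AnomForallVacuity.lean,
  sha16 852755c447c7e195; its `IsTopGenerator` / `IsTorsion` / `Module.Finite` / second-order binders
  are carried but not needed).

USE (cell b2b-bsdres, records only; nothing booked, no label moved, NO evidence / coverage status
claimed): the cell's typed leading-term inputs (`Delbourgo2002.LeadingTermClauses W p Dh`, Schneider /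
Perrin-Riou shapes) quantify over ALL instantiations `(κ, γ, D, f_E)` and read off `[T^r] f_E`; this
file records that the NORM of that coefficient is tuple-independent — the Λ-side lemma behind the
cell's consumer rule on `∀ Dh`-packagings (lead R5-65 (m); route planner 3, ROUTE-3.md l.114 / l.117
(D)). The anomalous-unit-row vacuity statements of record are census-ctyper1's p285577 / p286375
(a route that does not use this file). No statement about any curve is made here.

## References

* [Washington1997] L. C. Washington, *Introduction to Cyclotomic Fields*, 2nd ed., §7.1 (Thm. 7.1:
  `ℤ_p⟦Γ⟧ ≅ ℤ_p⟦T⟧`), §13.1 (`ℤ_p`-extensions, `Aut ℤ_p = ℤ_pˣ`), §13.2 (characteristic power series up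
  to `Λˣ`; change of topological generator).
* [GreenbergLNM1716] R. Greenberg, *Iwasawa theory for elliptic curves*, LNM 1716 (1999), §1 (p. 60 of
  the held Cetraro volume `book:coatesnd-arithmetic-theory-elliptic-curves`: the `Λ`-module `X(E/F_∞)`).
* [MazurTateTeitelbaum1986] B. Mazur, J. Tate, J. Teitelbaum, Invent. Math. 84 (1986), §I.13 (the
  variable `T = γ_cyc − 1` of `L_p(E,T)`).
-/

open Literature.NumberTheory Literature.NumberTheory.EllipticCurves PowerSeries

universe u

noncomputable section

namespace Literature.NumberTheory.EllipticCurves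

namespace IwasawaAlgebra

/-! ## §1 Algebra in `Λ = ℤ_p⟦T⟧`: the lowest coefficient of an associate -/

/-- **Lowest-coefficient multiplicativity**: if `ord_T f = n` then `[T^n](w·f) = w(0)·[T^n]f` (in
`∑_{i+j=n} w_i f_j` only `(i,j) = (0,n)` survives, `f_j = 0` for `j < n` by `PowerSeries.coeff_of_lt_order`).
[folklore] -/
private theorem coeff_mul_eq_constantCoeff_mul_of_order_eq {R : Type*} [CommRing R] {f : PowerSeries R}
    {n : ℕ} (hf : f.order = n) (w : PowerSeries R) :
    coeff n (w * f) = constantCoeff w * coeff n f := by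
  rw [coeff_mul, Finset.sum_eq_single (0, n)]
  · simp
  · rintro ⟨i, j⟩ hij hne
    have hij' : i + j = n := by simpa using hij
    rcases (show j < n ∨ j = n by omega) with hj | hj
    · rw [coeff_of_lt_order j (by rw [hf]; exact_mod_cast hj), mul_zero]
    · exact absurd (by ext <;> simp <;> omega) hne
  · intro h; exact absurd (by simp) h

variable {p : ℕ} [Fact p.Prime]

/-- **Associated elements of `Λ = ℤ_p⟦T⟧` have lowest coefficients of the same `p`-adic norm**: if
`(f) = (g)` as ideals of `Λ` and `ord_T f = n`, then `‖[T^n] g‖ = ‖[T^n] f‖` — `g = f·u` with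
`u ∈ Λˣ` (`Ideal.span_singleton_eq_span_singleton`, `Λ` a domain), `[T^n] g = u(0)·[T^n] f`
(`coeff_mul_eq_constantCoeff_mul_of_order_eq`), and `u(0) ∈ ℤ_pˣ` has norm `1`
(`PowerSeries.isUnit_iff_constantCoeff`, `PadicInt.isUnit_iff`). Washington §7.1 / §13.2 (the
characteristic power series is well defined up to `Λˣ`). [cite: Washington1997, §13.2] -/
theorem norm_coeff_eq_of_span_singleton_eq {f g : PowerSeries ℤ_[p]}
    (h : Ideal.span {f} = Ideal.span {g}) {n : ℕ} (hf : f.order = n) :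
    ‖((coeff n g : ℤ_[p]) : ℚ_[p])‖ = ‖((coeff n f : ℤ_[p]) : ℚ_[p])‖ := by
  rw [Ideal.span_singleton_eq_span_singleton] at h
  obtain ⟨u, rfl⟩ := h
  rw [mul_comm, coeff_mul_eq_constantCoeff_mul_of_order_eq hf, PadicInt.coe_mul, norm_mul,
    ← PadicInt.norm_def,
    PadicInt.isUnit_iff.mp (PowerSeries.isUnit_iff_constantCoeff.mp u.isUnit), one_mul]

end IwasawaAlgebra

end Literature.NumberTheory.EllipticCurves

/-! ## §2 Fixed `(κ, γ)`: two data, two generators -/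

namespace WeierstrassCurve

namespace SelmerDualData

variable {p : ℕ} [Fact p.Prime] {K : Type u} [Field K] [NumberField K] (W : WeierstrassCurve K)
  (κ : ZpExtension K p)

/-- **Fixed `(κ, γ)`: the norm of the lowest coefficient of a generator of `char_Λ X(E/K_∞)` does
not depend on the Pontryagin-dual datum nor on the generator** — `D.charIdeal = D'.charIdeal`
(`SelmerDualData.charIdeal_eq`, uniqueness of the Iwasawa module up to `Λ`-isomorphism; Greenberg,
LNM 1716, §1 p. 60), then §1. [cite: GreenbergLNM1716, §1 p. 60] [cite: Washington1997, §13.2] -/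
theorem norm_coeff_charGenerator_eq {γ : Field.absoluteGaloisGroup K}
    (D D' : W.SelmerDualData κ γ) {f f' : IwasawaAlgebra p}
    (hf : D.charIdeal = Ideal.span {f}) (hf' : D'.charIdeal = Ideal.span {f'})
    {n : ℕ} (hn : f.order = n) :
    ‖((coeff n f' : ℤ_[p]) : ℚ_[p])‖ = ‖((coeff n f : ℤ_[p]) : ℚ_[p])‖ :=
  IwasawaAlgebra.norm_coeff_eq_of_span_singleton_eq (hf.symm.trans ((D.charIdeal_eq D').trans hf')) hn

/-! ## §3 Change of `γ` inside its class modulo `ker κ`; two cyclotomic variables -/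

/-- Transport of the `γ`-dependent fields of a `SelmerDualData` along an equality `c' = c` of
conjugation maps on `H¹(K_∞, E[p^∞])` (auxiliary, by `subst`; the pattern of
`SelmerDualData.exists_fields_of_eq`). [folklore] -/
private theorem exists_fields_of_conjH1_eq
    {c c' : W.subgroupH1 p κ.kerSubgroup →+ W.subgroupH1 p κ.kerSubgroup} (hc : c' = c)
    (X : Type u) [AddCommGroup X] [Module (IwasawaAlgebra p) X]
    (conj_mem₀ : ∀ s ∈ W.selmerInfty κ, c s ∈ W.selmerInfty κ)
    (toDual₀ : X →+ (W.selmerInfty κ →+ AddCircle (1 : ℚ)))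
    (hT₀ : ∀ (x : X) (s : W.selmerInfty κ),
      toDual₀ ((PowerSeries.X : IwasawaAlgebra p) • x) s =
        toDual₀ x ⟨c s, conj_mem₀ s s.2⟩ - toDual₀ x s) :
    ∃ (conj_mem : ∀ s ∈ W.selmerInfty κ, c' s ∈ W.selmerInfty κ),
      ∀ (x : X) (s : W.selmerInfty κ),
        toDual₀ ((PowerSeries.X : IwasawaAlgebra p) • x) s =
          toDual₀ x ⟨c' s, conj_mem s s.2⟩ - toDual₀ x s := by
  subst hc
  exact ⟨conj_mem₀, hT₀⟩

/-- **Change of `γ` inside its class modulo `ker κ`.** If `γ⁻¹γ' ∈ ker κ = Gal(K̄/K_∞)`, a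
Pontryagin-dual datum over `(κ, γ)` yields one over `(κ, γ')` with literally the same Iwasawa module
(same type `X`, same `Λ`-structure), hence the same `IsTorsion`, `charIdeal`, finiteness: elements of
`Gal(K̄/K_∞)` act trivially on `H¹(K_∞, E[p^∞])` (`conjH1_of_mem_holds`, Serre, *Local Fields*
VII.§5 Prop. 3), so `conj_{γ'} = conj_γ ∘ conj_{γ⁻¹γ'} = conj_γ` (`conjH1_mul_holds`) and `T = γ - 1
= γ' - 1` on `Sel_{p^∞}(E/K_∞)`. Greenberg, LNM 1716, §1 (the `Λ`-structure is that of
`ℤ_p⟦Gal(K_∞/K)⟧`). [cite: GreenbergLNM1716, §1 p. 60] -/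
theorem exists_of_inv_mul_mem_kerSubgroup {γ γ' : Field.absoluteGaloisGroup K}
    (h : γ⁻¹ * γ' ∈ κ.kerSubgroup) (D : W.SelmerDualData κ γ) :
    ∃ D' : W.SelmerDualData κ γ',
      (D'.IsTorsion ↔ D.IsTorsion) ∧ D'.charIdeal = D.charIdeal ∧
      (Module.Finite (IwasawaAlgebra p) D'.X ↔ Module.Finite (IwasawaAlgebra p) D.X) := by
  have hconj : W.conjH1 p κ.kerSubgroup γ' = W.conjH1 p κ.kerSubgroup γ := by
    have hmul := W.conjH1_mul_holds p κ.kerSubgroup γ (γ⁻¹ * γ')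
    rw [mul_inv_cancel_left] at hmul
    rw [hmul, (W.conjH1_of_mem_holds p κ.kerSubgroup) h, AddMonoidHom.comp_id]
  obtain ⟨conj_mem, hT⟩ := exists_fields_of_conjH1_eq W κ hconj D.X D.conj_mem D.toDual
    D.toDual_T_smul
  exact ⟨{ X := D.X, conj_mem := conj_mem, toDual := D.toDual, bijective := D.bijective,
           toDual_T_smul := hT, toDual_C_smul := D.toDual_C_smul }, Iff.rfl, rfl, Iff.rfl⟩

end SelmerDualData

end WeierstrassCurve

namespace Literature.NumberTheory.EllipticCurves.ZpExtension

variable {p : ℕ} [Fact p.Prime]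

/-- **Two elements of `Γ_ℚ` matching the cyclotomic variable differ by an element of `ker κ`** for a
cyclotomic `κ` (`ker κ = χ_p⁻¹(μ(ℤ_p))`, `ZpExtension.IsCyclotomic`): from
`χ_p(γ)·ζ = γ_cyc = χ_p(γ')·ζ'` (`IsCyclotomicVariable`, torsion units `ζ, ζ'`) one gets
`χ_p(γ⁻¹γ') = ζζ'⁻¹ ∈ μ(ℤ_p)`. Mazur–Tate–Teitelbaum (1986), §I.13 (the variable of `L_p(E,T)`);
Washington §13.1. [cite: MazurTateTeitelbaum1986, §I.13] [cite: Washington1997, §13.1] -/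
theorem IsCyclotomic.inv_mul_mem_kerSubgroup_of_isCyclotomicVariable {κ : ZpExtension ℚ p}
    (hκ : κ.IsCyclotomic) {γ γ' : Field.absoluteGaloisGroup ℚ}
    (hγ : IsCyclotomicVariable p γ) (hγ' : IsCyclotomicVariable p γ') :
    γ⁻¹ * γ' ∈ κ.kerSubgroup := by
  obtain ⟨ζ, hζ, h⟩ := hγ
  obtain ⟨ζ', hζ', h'⟩ := hγ'
  rw [hκ, Subgroup.mem_comap, CommGroup.mem_torsion]
  change IsOfFinOrder (GaloisRepresentations.GaloisRep.cyclotomicCharacter ℚ p (γ⁻¹ * γ'))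
  have hu : GaloisRepresentations.GaloisRep.cyclotomicCharacter ℚ p γ * ζ =
      GaloisRepresentations.GaloisRep.cyclotomicCharacter ℚ p γ' * ζ' :=
    Units.ext (h.trans h'.symm)
  have hquot : GaloisRepresentations.GaloisRep.cyclotomicCharacter ℚ p (γ⁻¹ * γ') = ζ * ζ'⁻¹ := by
    rw [map_mul, map_inv]
    calc (GaloisRepresentations.GaloisRep.cyclotomicCharacter ℚ p γ)⁻¹
          * GaloisRepresentations.GaloisRep.cyclotomicCharacter ℚ p γ'
        = (GaloisRepresentations.GaloisRep.cyclotomicCharacter ℚ p γ)⁻¹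
          * (GaloisRepresentations.GaloisRep.cyclotomicCharacter ℚ p γ' * ζ') * ζ'⁻¹ := by group
      _ = (GaloisRepresentations.GaloisRep.cyclotomicCharacter ℚ p γ)⁻¹
          * (GaloisRepresentations.GaloisRep.cyclotomicCharacter ℚ p γ * ζ) * ζ'⁻¹ := by rw [hu]
      _ = ζ * ζ'⁻¹ := by group
  rw [hquot]
  exact hζ.mul hζ'.inv

end Literature.NumberTheory.EllipticCurves.ZpExtension

namespace WeierstrassCurve

namespace SelmerDualData

variable {p : ℕ} [Fact p.Prime]

/-! ## §4 The leading-coefficient norm is one number across cyclotomic instantiations -/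

/-- **MAIN — leading-coefficient-NORM twin of `SelmerDualData.order_charGenerator_eq`.** For
`E/ℚ`, a prime `p`, cyclotomic `ℤ_p`-extension data `κ, κ'` (both cut out `ℚ_∞`:
`ZpExtension.IsCyclotomic.kerSubgroup_eq`), elements `γ, γ' ∈ Γ_ℚ` matching the cyclotomic variable,
ANY Pontryagin-dual data `D` over `(κ, γ)` and `D'` over `(κ', γ')` of `Sel_{p^∞}(E/ℚ_∞)` with
principal characteristic ideals `(f)`, `(f')`, and `ord_T f = n`:  **`‖[T^n] f'‖_p = ‖[T^n] f‖_p`.**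
Proof: transport `D'` to a datum over `(κ, γ')` (`SelmerDualData.exists_of_kerSubgroup_eq`) and then
over `(κ, γ)` (§3), keeping the characteristic ideal, and apply §2. In print: the characteristic power
series of `X(E/ℚ_∞)` is intrinsic up to `Λˣ` and the identification `ℤ_p⟦Γ⟧ ≅ ℤ_p⟦T⟧` depends only on
the image of `γ` in `Γ = Gal(ℚ_∞/ℚ)` (Washington, Thm. 7.1, §13.2; Greenberg, LNM 1716, §1).
[cite: Washington1997, §13.2] [cite: GreenbergLNM1716, §1 p. 60] -/
theorem norm_coeff_charGenerator_eq_of_isCyclotomic (W : WeierstrassCurve ℚ)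
    {κ κ' : ZpExtension ℚ p} (hκ : κ.IsCyclotomic) (hκ' : κ'.IsCyclotomic)
    {γ γ' : Field.absoluteGaloisGroup ℚ}
    (hγ : IsCyclotomicVariable p γ) (hγ' : IsCyclotomicVariable p γ')
    (D : W.SelmerDualData κ γ) (D' : W.SelmerDualData κ' γ') {f f' : IwasawaAlgebra p}
    (hf : D.charIdeal = Ideal.span {f}) (hf' : D'.charIdeal = Ideal.span {f'})
    {n : ℕ} (hn : f.order = n) :
    ‖((coeff n f' : ℤ_[p]) : ℚ_[p])‖ = ‖((coeff n f : ℤ_[p]) : ℚ_[p])‖ := by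
  -- move `D'` from `(κ', γ')` to `(κ, γ')` (same kernel: both cyclotomic) …
  obtain ⟨D₁, -, hD₁, -⟩ :=
    exists_of_kerSubgroup_eq (W := W)
      (ZpExtension.IsCyclotomic.kerSubgroup_eq hκ' hκ) D'
  -- … and from `(κ, γ')` to `(κ, γ)` (`γ'⁻¹γ ∈ ker κ`: both match the cyclotomic variable)
  obtain ⟨D₂, -, hD₂, -⟩ := exists_of_inv_mul_mem_kerSubgroup W κ
    (ZpExtension.IsCyclotomic.inv_mul_mem_kerSubgroup_of_isCyclotomicVariable hκ hγ' hγ) D₁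
  exact norm_coeff_charGenerator_eq W κ D D₂ hf (hD₂.trans (hD₁.trans hf')) hn

end SelmerDualData

variable {p : ℕ} [Fact p.Prime] in
/-- **`CharCoeffNormUniform W p` — route planner 3's scratch `Prop`, PROVED in its own binder shape**
(`HOME/b2b-bsdres-n1011-r3/g18/AnomForallVacuity.lean`, `R3Scratch.CharCoeffNormUniform`; the
binders `IsTopGenerator`, `IsTorsion`, `Module.Finite` and the second order hypothesis are carried but
unused): across all admissible instantiations `(κ, γ, D, f_E)` of the cell's leading-term clauses,
the `r`-th coefficient of a characteristic power series with `ord_T f_E = r = rank E(ℚ)` has ONE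
`p`-adic norm. One line over `norm_coeff_charGenerator_eq_of_isCyclotomic`. (Cell use: records only; no evidence status claimed.)
[cite: Washington1997, §13.2] -/
theorem charCoeffNormUniform (W : WeierstrassCurve ℚ) :
    ∀ (κ : ZpExtension ℚ p) (γ : Field.absoluteGaloisGroup ℚ),
      κ.IsCyclotomic → κ.IsTopGenerator γ → IsCyclotomicVariable p γ →
      ∀ (D : W.SelmerDualData κ γ) [Module.Finite (IwasawaAlgebra p) D.X], D.IsTorsion →
      ∀ (fE : IwasawaAlgebra p), D.charIdeal = Ideal.span {fE} →
    ∀ (κ' : ZpExtension ℚ p) (γ' : Field.absoluteGaloisGroup ℚ),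
      κ'.IsCyclotomic → κ'.IsTopGenerator γ' → IsCyclotomicVariable p γ' →
      ∀ (D' : W.SelmerDualData κ' γ') [Module.Finite (IwasawaAlgebra p) D'.X], D'.IsTorsion →
      ∀ (fE' : IwasawaAlgebra p), D'.charIdeal = Ideal.span {fE'} →
      fE.order = W.mordellWeilRank → fE'.order = W.mordellWeilRank →
      ‖((PowerSeries.coeff W.mordellWeilRank fE : ℤ_[p]) : ℚ_[p])‖ =
        ‖((PowerSeries.coeff W.mordellWeilRank fE' : ℤ_[p]) : ℚ_[p])‖ :=
  fun _κ _γ hκ _ hγ D _ _ _fE hfE _κ' _γ' hκ' _ hγ' D' _ _ _fE' hfE' ho _ ↦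
    (SelmerDualData.norm_coeff_charGenerator_eq_of_isCyclotomic W hκ hκ' hγ hγ' D D' hfE hfE' ho).symm

end WeierstrassCurve

end
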